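import Summits.FinalStateConjecture.FinalStateConjecture.Theorems.PhaseMixingCaptureNearExtremalKappaCaptureKerrSlabCauchy
import Literature.Geometry.Lorentzian.KerrDataEmbedding
import Literature.Geometry.Lorentzian.CauchyDevelopmentRestrict
import Literature.Geometry.Lorentzian.DataEmbeddingNormalSmooth
import Literature.Geometry.Lorentzian.KerrConvergence
import Literature.Geometry.Lorentzian.KerrSurfaceGravity
import HarnessLib

/-!
# Crux `PhaseMixingCapture.NearExtremalKappaCapture` (stmt-FinalStateConjecture-10606), line
# `unit-temperature-front-face`, helper for stub S3 `stub_thermalTimeStability`, part 2: the Kerr slab is a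
# vacuum Cauchy development of the exact Kerr data, and the CENTRE CASE of S3

Stub S3 (`stub_thermalTimeStability`, anchored thermal-time Cauchy stability of the maximal developments of
near-Kerr data on the Kerr–Schild slice `Kerr.slice a M = {t* = 0, r > M}`) demands, at the centre of its data
ball (`D = Kerr.data M a M`, distance `0`, deviation bound `C χ^{-p} √0 = 0`), for EVERY maximal vacuum Cauchy
development `𝒟` of the exact Kerr data, a chart `Ψ : Kerr.region a M → 𝒟` which is a smooth open embedding on
the slab `{0 < t* < T'}`, continuous up to `t* = 0` where `Ψ(0, y) = ι_𝒟(y)`, and an EXACT isometry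
(`Spacetime.deviationCk = 0`) on every leaf `{t* = τ}`, `τ > 0`. This file proves that centre case outright
(`KerrSlab.centre_chart`; the registered sub-goal `stub_thermalTimeStabilityCentre` is S3's conclusion
verbatim at `D := Kerr.data M a M hM.le`), by constructing the one object it hinges on:

* `KerrSlab.development hM ha : VacuumCauchyDevelopment (Kerr.data M a M hM.le)` (`0 < M`, `|a| < M`) — the
  Kerr chart `Kerr.dataEmbedding M a M` (`KerrDataEmbedding.lean`: `(Kerr.region a M, g_{M,a}, −g♯dt*)`,
  `ι = sliceEmbed`, `ν = sliceNormal`, vacuum by `Kerr.ricci_smoothMetric`) restricted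
  (`DataEmbedding.restrict`, Sbierski 2016, Def. 2.4) to the slab domain `KerrSlab.domain a M` of part 1
  (`PhaseMixingCaptureNearExtremalKappaCaptureKerrSlabCauchy.lean`), in which the slice IS a Cauchy hypersurface
  (`KerrSlab.cauchy_chart`, via the chart/sub-spacetime dictionary of `OpensCausality`): realised inside the
  chart by the inclusion `KerrSlab.incl = Subtype.val` (smooth, open embedding, isometric, time-orientation
  preserving, `incl ∘ ι = sliceEmbed`, `{t* ≥ 0} ⊆ range incl`; `KerrSlab.incl_realises`).

The centre case then is plumbing: maximality embeds `KerrSlab.development` into `𝒟` by some `ψ`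
(`VacuumCauchyDevelopment.IsMaximal`, Ringström 2009, Def. 16.5); `Ψ := ψ` on the domain (junk elsewhere) is
smooth there (`contMDiffAt_subtype_iff`), an open embedding on the open slab, anchored (`ψ ∘ ι = ι_𝒟`), and
`Ψ^* g_𝒟 = g_{M,a}` on the domain (`dψ = dΨ ∘ d(val)`, `d(val) = id`), so the metric deviation vanishes on an
open subset of `E4` containing every leaf `{t* = τ}`, `τ > 0`, together with all its derivatives.

Nothing here restates S3 (off the centre S3 is a genuine anchored Cauchy-stability statement for the vacuum
Einstein equations, for which the tree has no carrier); no named fact is consumed (`[Kerr.Facts]`,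
`[Kerr.SliceFacts]` are the standing instance hypotheses of `Kerr.data`).

References: J. Sbierski, Ann. Henri Poincaré 17 (2016), Def. 2.4; H. Ringström, *The Cauchy problem in General
Relativity* (2009), Def. 16.2–16.5; Y. Choquet-Bruhat, R. Geroch, CMP 14 (1969), p. 332; M. Dafermos,
I. Rodnianski, arXiv:0811.0354, §5.1.
-/

set_option linter.dupNamespace false

noncomputable section

open Set Filter Function TopologicalSpace Topology
open scoped Manifold ContDiff Topology ENNReal
open Literature.Geometry.Lorentzian

namespace Summit.FinalStateConjecture.FinalStateConjecture.Theorems.NearExtremalKappaCapture.UnitTemperatureFrontFace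

namespace KerrSlab

variable {M a : ℝ}

/-! ## The Kerr slab as a vacuum Cauchy development of `Kerr.data M a M` -/

section Development

variable [Kerr.Facts] [Kerr.SliceFacts]

/-- **The Kerr slab is a vacuum Cauchy development of the exact Kerr data** `Kerr.data M a M hM.le` (`0 < M`,
`|a| < M`): the Kerr chart data embedding `Kerr.dataEmbedding M a M hM.le` (`Kerr.region a M`, `g_{M,a}`,
`−g♯dt*`, `ι = sliceEmbed`, `ν = sliceNormal`) restricted to the open connected slab domain
(`DataEmbedding.restrict`; Sbierski 2016, Def. 2.4), in which the slice is a Cauchy hypersurface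
(`cauchy_chart`, via the chart/sub-spacetime dictionary of `OpensCausality`), and which is vacuum
(`Kerr.dataEmbedding_isVacuum`, `DataEmbedding.isRicciFlat_restrict`). [cite: Sbierski2016AHP, Def. 2.4] -/
def development (hM : 0 < M) (ha : |a| < M) : VacuumCauchyDevelopment (Kerr.data M a M hM.le) where
  toDataEmbedding := (Kerr.dataEmbedding M a M hM.le).restrict (domain a M) isConnected_domain
    sliceEmbed_mem_domain (Kerr.dataEmbedding M a M hM.le).mdifferentiableAt_embed_normal
  isCauchyHypersurface := by
    intro γ s hγ
    obtain ⟨hs, htl, hfe, hpe⟩ := hγ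
    have htl' := (LorentzianMetric.isFutureTimelikeCurveOn_restrict_iff _ _ _ _ _).1 htl
    have hW : ∀ t ∈ s, (Subtype.val ∘ γ) t ∈ domain a M := fun t _ ↦ (γ t).2
    have hend : ∀ q : Kerr.region a M, q ∈ domain a M →
        ¬ HasFutureEndpoint (Subtype.val ∘ γ) s q ∧ ¬ HasPastEndpoint (Subtype.val ∘ γ) s q :=
      fun q hq ↦ ⟨fun h ↦ hfe.2 ⟨q, hq⟩ (hasFutureEndpoint_subtypeVal_comp_iff.1 h),
        fun h ↦ hpe.2 ⟨q, hq⟩ (hasPastEndpoint_subtypeVal_comp_iff.1 h)⟩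
    obtain ⟨t, ⟨hts, ht⟩, huniq⟩ := cauchy_chart hM.le ha (Subtype.val ∘ γ) s hs hfe.1 htl' hW hend
    refine ⟨t, ⟨hts, ?_⟩, fun t' ht' ↦ huniq t' ⟨ht'.1, ?_⟩⟩
    · obtain ⟨y, hy⟩ := (exists_sliceEmbed_eq_iff (x := (Subtype.val ∘ γ) t)).2 ht
      exact ⟨y, Subtype.ext hy⟩
    · obtain ⟨y, hy⟩ := ht'.2
      exact (exists_sliceEmbed_eq_iff (x := (Subtype.val ∘ γ) t')).1 ⟨y, congrArg Subtype.val hy⟩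
  isRicciFlat := by
    intro instLC
    haveI : ((Kerr.dataEmbedding M a M hM.le).metric.restrict PseudoRiemannianMetric.contMDiff_restrict_holds
        (domain a M)).toPseudoRiemannianMetric.HasLeviCivita := instLC
    exact (Kerr.dataEmbedding M a M hM.le).isRicciFlat_restrict (domain a M)
      (Kerr.dataEmbedding_isVacuum M a M hM.le)

/-- The carrier of the Kerr slab development is the slab domain (by `rfl`). [folklore] -/
theorem development_carrier (hM : 0 < M) (ha : |a| < M) :
    (development hM ha).carrier = ↥(domain a M) :=
  rfl

/-- **The inclusion of the Kerr slab development in the chart** `Kerr.region a M` (`j := Subtype.val`).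
[folklore] -/
def incl (hM : 0 < M) (ha : |a| < M) : (development hM ha).carrier → Kerr.region a M :=
  Subtype.val

/-- The inclusion is the first projection (by `rfl`). [folklore] -/
theorem incl_apply (hM : 0 < M) (ha : |a| < M) (p : domain a M) : incl hM ha p = p.1 :=
  rfl

/-- The embedding of the Kerr slab development, followed by the inclusion in the chart, is the slice embedding
`y ↦ (0, y)` (by `rfl`). [folklore] -/
theorem incl_embed (hM : 0 < M) (ha : |a| < M) (y : Kerr.slice a M) :
    incl hM ha ((development hM ha).embed y) = Kerr.sliceEmbed a M y :=
  rfl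

/-- **The Kerr slab development embeds into the Kerr chart** (`Kerr.dataEmbedding M a M`) by the inclusion
(`DataEmbedding.restrict_embedsInto`). [cite: Sbierski2016AHP, Def. 2.4] -/
theorem development_embedsInto (hM : 0 < M) (ha : |a| < M) :
    (development hM ha).toDataEmbedding.EmbedsInto (Kerr.dataEmbedding M a M hM.le) :=
  (Kerr.dataEmbedding M a M hM.le).restrict_embedsInto (domain a M) isConnected_domain sliceEmbed_mem_domain
    (Kerr.dataEmbedding M a M hM.le).mdifferentiableAt_embed_normal

/-- **The inclusion realises the Kerr slab development inside the chart**: `j = incl hM ha` (`Subtype.val`) is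
smooth, an open embedding, isometric (`(g|_U)_p = g_p`, `dj = id`), time-orientation preserving, satisfies
`j ∘ ι = sliceEmbed`, and its range (the slab domain) contains the half-chart `{t* ≥ 0}`.
[cite: Ringstrom2009, Def. 16.5] -/
theorem incl_realises (hM : 0 < M) (ha : |a| < M) :
    ContMDiff (𝓡 4) 𝓘(ℝ, E4) ∞ (incl hM ha) ∧ IsOpenEmbedding (incl hM ha) ∧
    (development hM ha).metric.IsIsometricImmersion (Kerr.smoothMetric M a M).toPseudoRiemannianMetric
      (incl hM ha) ∧
    (development hM ha).timeOrientation.PreservesTimeOrientation (incl hM ha)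
      ((Kerr.timeOrientation M a M hM.le).ofLE le_top) ∧
    incl hM ha ∘ (development hM ha).embed = Kerr.sliceEmbed a M ∧
    {x : Kerr.region a M | 0 ≤ (x : E4) 0} ⊆ range (incl hM ha) := by
  refine ⟨contMDiff_subtype_val, (domain a M).2.isOpenEmbedding_subtypeVal,
    ⟨contMDiff_subtype_val, fun p ↦ ?_⟩, fun p ↦ ?_, rfl, fun x hx ↦ ⟨⟨x, mem_domain_of_nonneg hx⟩, rfl⟩⟩
  · ext v w
    change (Kerr.smoothMetric M a M).val p.1
        (mfderiv (𝓡 4) (𝓡 4) (Subtype.val : domain a M → Kerr.region a M) p v)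
        (mfderiv (𝓡 4) (𝓡 4) (Subtype.val : domain a M → Kerr.region a M) p w) =
      (Kerr.smoothMetric M a M).val p.1 v w
    rw [mfderiv_subtypeVal]
    rfl
  · change (Kerr.dataEmbedding M a M hM.le).timeOrientation.IsFutureDirected
      (mfderiv (𝓡 4) (𝓡 4) (Subtype.val : domain a M → Kerr.region a M) p
        ((Kerr.dataEmbedding M a M hM.le).timeOrientation.vectorField p.1))
    rw [mfderiv_subtypeVal]
    exact (Kerr.dataEmbedding M a M hM.le).timeOrientation.isFutureDirected_vectorField p.1

end Development

/-! ## The centre case of S3: an anchored, exactly isometric chart into every maximal development -/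

section Centre

variable [Kerr.Facts] [Kerr.SliceFacts]

/-- **Centre case of stub S3 (`stub_thermalTimeStability`) — every maximal vacuum Cauchy development of the
exact Kerr data carries an anchored, exactly isometric copy of the Kerr slab.** For `0 < M`, `|a| < M`, every
`T'` and `k`, and every MAXIMAL `𝒟 : VacuumCauchyDevelopment (Kerr.data M a M hM.le)`, there is
`Ψ : Kerr.region a M → 𝒟` which is `C^∞` and an open embedding on the open slab `{0 < t* < T'}`, continuous on
`{0 ≤ t* < T'}`, anchored (`Ψ(0, y) = ι_𝒟 y`), and whose metric deviation from `g_{M,a}`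
(`Spacetime.deviationCk` for the background `⟨Kerr.region a M, Kerr.bilin M a, t*, r⟩` of S3) VANISHES on every
leaf `{t* = τ}`, `τ > 0`, at every order `k`. Proof: maximality (`VacuumCauchyDevelopment.IsMaximal`) embeds
`KerrSlab.development hM ha` into `𝒟` by an isometric open embedding `ψ` over the slice; `Ψ := ψ` on the slab
domain. [cite: Ringstrom2009, Def. 16.5] -/
theorem centre_chart (hM : 0 < M) (ha : Kerr.IsSubextremal M a) (T' : ℝ) (k : ℕ)
    (𝒟 : VacuumCauchyDevelopment (Kerr.data M a M hM.le)) (h𝒟 : 𝒟.IsMaximal) :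
    ∃ Ψ : Kerr.region a M → 𝒟.carrier,
      ContMDiffOn 𝓘(ℝ, E4) (𝓡 4) ∞ Ψ {x | 0 < x.1 0 ∧ x.1 0 < T'} ∧
      IsOpenEmbedding ({x : Kerr.region a M | 0 < x.1 0 ∧ x.1 0 < T'}.restrict Ψ) ∧
      ContinuousOn Ψ {x | 0 ≤ x.1 0 ∧ x.1 0 < T'} ∧
      (∀ y : Kerr.slice a M,
        Ψ ⟨E4.ofTimeSpace 0 (y : E3), Kerr.mem_slice_iff_ofTimeSpace_mem_region.1 y.2⟩ = 𝒟.embed y) ∧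
      ∀ τ : ℝ, 0 < τ →
        𝒟.toSpacetime.deviationCk ⟨Kerr.region a M, Kerr.bilin M a, fun x ↦ x 0, Kerr.radius a⟩ Ψ k τ = 0 := by
  classical
  obtain ⟨ψ, hψs, hψo, hψi, -, hψe⟩ := h𝒟 (development hM ha)
  obtain ⟨y₀, hy₀⟩ := (Kerr.isConnected_slice_holds a M).nonempty
  set B : ModelBackground := ⟨Kerr.region a M, Kerr.bilin M a, fun x ↦ x 0, Kerr.radius a⟩ with hB
  -- the chart: `ψ` on the slab domain, junk elsewhere
  let Ψ : Kerr.region a M → 𝒟.carrier := fun x ↦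
    if hx : x ∈ domain a M then ψ ⟨x, hx⟩ else ψ ((development hM ha).embed ⟨y₀, hy₀⟩)
  have hΨ : ∀ (x : Kerr.region a M) (hx : x ∈ domain a M), Ψ x = ψ ⟨x, hx⟩ := fun x hx ↦ dif_pos hx
  have hΨval : Ψ ∘ (Subtype.val : domain a M → Kerr.region a M) = ψ := by
    funext p
    change Ψ p.1 = ψ p
    rw [hΨ p.1 p.2]
    exact congrArg ψ (Subtype.ext rfl)
  -- smoothness on the (open) slab domain
  have hsmooth : ∀ x : Kerr.region a M, x ∈ domain a M → ContMDiffAt 𝓘(ℝ, E4) (𝓡 4) ∞ Ψ x := by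
    intro x hx
    have h1 : ContMDiffAt 𝓘(ℝ, E4) (𝓡 4) ∞ (fun p : domain a M ↦ Ψ p.1) ⟨x, hx⟩ := by
      rw [show (fun p : domain a M ↦ Ψ p.1) = ψ from hΨval]
      exact hψs ⟨x, hx⟩
    exact (contMDiffAt_subtype_iff (U := domain a M) (f := Ψ) (x := ⟨x, hx⟩)).1 h1
  -- the pulled-back metric is the Kerr metric on the slab domain
  have hpull : ∀ (x : Kerr.region a M) (hx : x ∈ domain a M),
      @Eq (E4 →L[ℝ] E4 →L[ℝ] ℝ) (pullbackBilin (I := 𝓡 4) (I' := 𝓘(ℝ, E4)) Ψ 𝒟.metric.val x)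
        (Kerr.bilin M a x) := by
    intro x hx
    have hmd : MDifferentiableAt 𝓘(ℝ, E4) (𝓡 4) Ψ x := (hsmooth x hx).mdifferentiableAt (by simp)
    have hval : MDifferentiableAt (𝓡 4) 𝓘(ℝ, E4) (Subtype.val : domain a M → Kerr.region a M) ⟨x, hx⟩ :=
      (contMDiff_subtype_val (n := ∞) (U := domain a M) ⟨x, hx⟩).mdifferentiableAt (by simp)
    have hcomp : mfderiv (𝓡 4) (𝓡 4) (Ψ ∘ (Subtype.val : domain a M → Kerr.region a M)) ⟨x, hx⟩ =
        mfderiv 𝓘(ℝ, E4) (𝓡 4) Ψ x := by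
      rw [mfderiv_comp _ hmd hval, mfderiv_subtypeVal]
      exact ContinuousLinearMap.ext fun v ↦ rfl
    have e1 : @Eq (E4 →L[ℝ] E4 →L[ℝ] ℝ) (pullbackBilin (I := 𝓡 4) (I' := 𝓘(ℝ, E4)) Ψ 𝒟.metric.val x)
        (pullbackBilin (I := 𝓡 4) (I' := 𝓡 4)
          (Ψ ∘ (Subtype.val : domain a M → Kerr.region a M)) 𝒟.metric.val ⟨x, hx⟩) := by
      ext v w
      change 𝒟.metric.val (Ψ x) (mfderiv 𝓘(ℝ, E4) (𝓡 4) Ψ x v) (mfderiv 𝓘(ℝ, E4) (𝓡 4) Ψ x w) =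
        𝒟.metric.val (Ψ x)
          (mfderiv (𝓡 4) (𝓡 4) (Ψ ∘ (Subtype.val : domain a M → Kerr.region a M)) ⟨x, hx⟩ v)
          (mfderiv (𝓡 4) (𝓡 4) (Ψ ∘ (Subtype.val : domain a M → Kerr.region a M)) ⟨x, hx⟩ w)
      rw [hcomp]
      rfl
    have e2 : @Eq (E4 →L[ℝ] E4 →L[ℝ] ℝ)
        (pullbackBilin (I := 𝓡 4) (I' := 𝓡 4)
          (Ψ ∘ (Subtype.val : domain a M → Kerr.region a M)) 𝒟.metric.val ⟨x, hx⟩)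
        ((development hM ha).metric.val ⟨x, hx⟩) := by
      rw [hΨval]
      exact hψi.2 ⟨x, hx⟩
    have e3 : @Eq (E4 →L[ℝ] E4 →L[ℝ] ℝ) ((development hM ha).metric.val ⟨x, hx⟩) (Kerr.bilin M a x) := rfl
    exact e1.trans (e2.trans e3)
  have hdev : ∀ (x : Kerr.region a M), x ∈ domain a M → 𝒟.toSpacetime.deviation B Ψ x = 0 := by
    intro x hx
    change (show E4 →L[ℝ] E4 →L[ℝ] ℝ from
      pullbackBilin (I := 𝓡 4) (I' := 𝓘(ℝ, E4)) Ψ 𝒟.toSpacetime.metric.val x) - Kerr.bilin M a x = 0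
    rw [hpull x hx]
    exact sub_self (Kerr.bilin M a x)
  -- the slab domain seen in `E4` is open, and the extended deviation vanishes on it with all derivatives
  have hVopen : IsOpen {z : E4 | ∃ hz : z ∈ Kerr.region a M, (⟨z, hz⟩ : Kerr.region a M) ∈ domain a M} := by
    have hV : {z : E4 | ∃ hz : z ∈ Kerr.region a M, (⟨z, hz⟩ : Kerr.region a M) ∈ domain a M} =
        Subtype.val '' (domain a M : Set (Kerr.region a M)) := by
      ext z
      constructor
      · rintro ⟨hz, h⟩
        exact ⟨⟨z, hz⟩, h, rfl⟩
      · rintro ⟨x, hx, rfl⟩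
        exact ⟨x.2, hx⟩
    rw [hV]
    exact (Kerr.region a M).2.isOpenMap_subtype_val _ (domain a M).2
  have hext : ∀ z : E4, (∃ hz : z ∈ Kerr.region a M, (⟨z, hz⟩ : Kerr.region a M) ∈ domain a M) →
      ∀ m : ℕ, iteratedFDeriv ℝ m (𝒟.toSpacetime.deviationExtend B Ψ) z = 0 := by
    intro z hz m
    have hloc : 𝒟.toSpacetime.deviationExtend B Ψ =ᶠ[𝓝 z] fun _ ↦ 0 := by
      filter_upwards [hVopen.mem_nhds hz] with z' hz'
      obtain ⟨hz'r, hz'd⟩ := hz'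
      exact (Spacetime.deviationExtend_coe 𝒟.toSpacetime B Ψ ⟨z', hz'r⟩).trans (hdev _ hz'd)
    rw [(Filter.EventuallyEq.iteratedFDeriv ℝ hloc m).eq_of_nhds, iteratedFDeriv_fun_zero]
    rfl
  refine ⟨Ψ, fun x hx ↦ (hsmooth x (mem_domain_of_nonneg hx.1.le)).contMDiffWithinAt, ?_,
    fun x hx ↦ (hsmooth x (mem_domain_of_nonneg hx.1)).continuousAt.continuousWithinAt, fun y ↦ ?_,
    fun τ hτ ↦ ?_⟩
  · -- open embedding on the open slab `S = {0 < t* < T'} ⊆ domain`: `Ψ|_S = ψ ∘ (S ↪ domain)`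
    have h0 : Continuous fun x : Kerr.region a M ↦ (x : E4) 0 :=
      (PiLp.continuous_apply 2 _ 0).comp continuous_subtype_val
    let S : Opens (Kerr.region a M) :=
      ⟨{x | 0 < (x : E4) 0 ∧ (x : E4) 0 < T'}, (isOpen_lt continuous_const h0).inter (isOpen_lt h0 continuous_const)⟩
    have hSU : S ≤ domain a M := fun x hx ↦ mem_domain_of_nonneg hx.1.le
    have hrestr : ({x : Kerr.region a M | 0 < (x : E4) 0 ∧ (x : E4) 0 < T'}).restrict Ψ =
        ψ ∘ Set.inclusion (show (S : Set (Kerr.region a M)) ⊆ domain a M from hSU) := by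
      funext x
      exact hΨ x.1 (hSU x.2)
    rw [hrestr]
    exact hψo.comp (Opens.isOpenEmbedding_of_le hSU)
  · -- anchoring: `Ψ (0, y) = ψ (ι y) = ι_𝒟 y`
    change Ψ (Kerr.sliceEmbed a M y) = 𝒟.embed y
    rw [hΨ _ (sliceEmbed_mem_domain y)]
    exact congrFun hψe y
  · -- the deviation vanishes identically near every point of the leaf `{t* = τ}`, `τ > 0`
    refine le_antisymm ?_ zero_le
    unfold Spacetime.deviationCk supCkENorm
    refine iSup₂_le fun m _ ↦ iSup₂_le fun z hz ↦ ?_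
    obtain ⟨x, hxτ, rfl⟩ := hz
    have hx0 : (x : E4) 0 = τ := hxτ
    have hxd : (⟨(x : E4), x.2⟩ : Kerr.region a M) ∈ domain a M :=
      mem_domain_of_nonneg (show 0 ≤ (x : E4) 0 by rw [hx0]; exact hτ.le)
    rw [hext (x : E4) ⟨x.2, hxd⟩ m, enorm_zero]

end Centre

/-- **Registered sub-goal `stub_thermalTimeStabilityCentre` — S3 at the centre of its data ball, in S3's own
shape.** For every thermal time `T`, order `k`, exponents `(s, δ, p)` and constant `C`, every `0 < M`, every
sub-extremal `a` and every maximal vacuum Cauchy development `𝒟` of the EXACT Kerr data `Kerr.data M a M hM.le`,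
the conclusion of `stub_thermalTimeStability` holds with `D := Kerr.data M a M hM.le`: the anchored chart of
`KerrSlab.centre_chart` on `{0 < t* < T/κ + 1}` (`κ = Kerr.surfaceGravity M a`) has deviation
`0 ≤ C χ^{-p} √dist` on every leaf `τ ∈ (0, T/κ]`. [cite: Ringstrom2009, Def. 16.5] -/
theorem _root_.Summit.FinalStateConjecture.FinalStateConjecture.Theorems.NearExtremalKappaCapture.UnitTemperatureFrontFace.stub_thermalTimeStabilityCentre :
    ∀ [Kerr.Facts] [Kerr.SliceFacts] (T : ℝ) (k s : ℕ) (δ p C : ℝ) (M : ℝ) (hM : 0 < M) (a : ℝ),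
    Kerr.IsSubextremal M a → ∀ (𝒟 : VacuumCauchyDevelopment (Kerr.data M a M hM.le)), 𝒟.IsMaximal →
    ∃ Ψ : Kerr.region a M → 𝒟.carrier,
      ContMDiffOn 𝓘(ℝ, E4) (𝓡 4) ∞ Ψ {x | 0 < x.1 0 ∧ x.1 0 < T / Kerr.surfaceGravity M a + 1} ∧
      Topology.IsOpenEmbedding
        ({x : Kerr.region a M | 0 < x.1 0 ∧ x.1 0 < T / Kerr.surfaceGravity M a + 1}.restrict Ψ) ∧
      ContinuousOn Ψ {x | 0 ≤ x.1 0 ∧ x.1 0 < T / Kerr.surfaceGravity M a + 1} ∧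
      (∀ y : Kerr.slice a M,
        Ψ ⟨E4.ofTimeSpace 0 (y : E3), Kerr.mem_slice_iff_ofTimeSpace_mem_region.1 y.2⟩ = 𝒟.embed y) ∧
      ∀ τ ∈ Ioc 0 (T / Kerr.surfaceGravity M a),
        𝒟.toSpacetime.deviationCk ⟨Kerr.region a M, Kerr.bilin M a, fun x ↦ x 0, Kerr.radius a⟩ Ψ k τ ≤
          ENNReal.ofReal (C * (1 - (a / M) ^ 2) ^ (-p) *
            √(InitialDataSet.dataWeightedSobolevEDist s δ (Kerr.data M a M hM.le) (Kerr.data M a M hM.le)).toReal) := by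
  intro _ _ T k s δ p C M hM a ha 𝒟 h𝒟
  obtain ⟨Ψ, h1, h2, h3, h4, h5⟩ := centre_chart hM ha (T / Kerr.surfaceGravity M a + 1) k 𝒟 h𝒟
  exact ⟨Ψ, h1, h2, h3, h4, fun τ hτ ↦ (h5 τ hτ.1).le.trans zero_le⟩

end KerrSlab

end Summit.FinalStateConjecture.FinalStateConjecture.Theorems.NearExtremalKappaCapture.UnitTemperatureFrontFace

end
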